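import Literature.Computability.Cryptography.LiuPassCondEPPRG
import HarnessLib

/-!
# The Goldreich–Levin theorem for hiding functions (hard-core bits from `𝒮`-hiding functions)

The computational ingredient of Liu–Pass's Lemma 5.3 (FOCS 2020, arXiv:2009.11514, Appendix,
"Hardcore functions and the Goldreich–Levin Theorem"): the Goldreich–Levin inner-product bits
`⟨x, σ₁⟩, …, ⟨x, σ_k⟩`, `k = d⌊log₂ n⌋`, are pseudorandom given `g(x, ρ)` and the seeds `σ`, for
every randomized function `g` that *hides* `x ← S_n` (no PPT algorithm recovers `x` itself from
`g(x, ρ)` except with negligible probability — weaker than one-wayness, where any preimage counts).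
Print (Liu–Pass, Appendix, Thm "[GL89], also see Theorem 2.12 in [HHR06]"): "There exists some `c` such that
for every `γ`, and every `m(·)`, there exists a polynomial-time computable function
`GL : {0,1}^{n + m(n) + n^c} → {0,1}^{γ log n}` such that the following holds: Let
`𝒮 = {S_n ⊆ {0,1}ⁿ}` and let `f : {0,1}ⁿ × {0,1}^{m(n)} → {0,1}^*` be `𝒮`-hiding. Then `GL` is a
hardcore function for `f'(x, r, σ) = σ ‖ f(x, r)`", where `g` is a hardcore function for `f`
over `𝒮` when `{x ← S_n : f(x) ‖ g(x)}` and `{x ← S_n : f(x) ‖ U}` are indistinguishable.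

This file fixes the notions and vendors the theorem as a **named fact** (D-0014):

* `ipBit x σ` (inner product over `𝔽₂`), `glBits k n x σ` (the `k` inner products of `x` with the
  consecutive `n`-blocks of `σ`);
* `blockSeeds S b n` — the seeds `x ‖ τ`, `x ∈ S_n`, `τ ∈ {0,1}^b` (the shape of `lpSeeds`);
* `hidingProb g 𝒜 S m n = Pr_{x ← S_n, ρ ← U_{m n}, coins}[𝒜(1ⁿ, g(x ‖ ρ)) = x]` and
  `IsHidingOver g S m` (print's "entropically-hiding over `𝒮`");
* `glReal g m k n`, `glIdeal g m k n` — the two ensembles as maps of the block seeds;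
* the named fact `goldreichLevin_hiding`, and unfolding lemmas (`glReal_seed`, `glIdeal_seed`,
  `length_glReal`, `card_blockSeeds`, …).

Rendering choices: the seed `σ` of `GL` consists of exactly `k·n` bits (print: `n^c` bits, of which
`GL` reads `γ log n` blocks; surplus uniform seed bits can always be moved into `ρ`, where `g` may
pass them through, without affecting hiding); `k = d⌊log₂ n⌋` with `Nat.log`; `m` is any function
(print: "every `m(·)`"); `g` acts on the concatenation `x ‖ ρ` (it is not required to be efficient —
the printed proof never evaluates `g`). The samples are ordered `g(x‖ρ) ‖ σ ‖ GL` whereas print's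
`f'(x, r, σ) ‖ GL` is `σ ‖ f(x, r) ‖ GL`: the two orders differ by a fixed permutation of blocks
whose position is computable from `n` alone (the suffix `σ ‖ GL` has length `k·n + k`), so a
distinguisher for one order is a distinguisher for the other and the statements are equivalent. The
ideal ensemble carries the `k` fresh bits as a fourth seed block. `ipBit` is the inner product of
the tree's Goldreich–Levin predicate `glPred` (`OneWayFunctions.lean`, used by the S24 fact
`goldreich_levin`) on two separate arguments (`glPred_append_eq_ipBit`), and
`blockSeeds S (3 n^c) n` is literally `lpSeeds S c n` of `LiuPassCondFromRegular.lean`. The levels `S_n` are required to be eventually nonempty (for `S_n = ∅` the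
conditioned distribution is a junk point mass on which the two maps differ). Not proved here: the printed proof is Rackoff's list decoding
(`GoldreichLevin.lean` has its combinatorial core, `goldreich_levin_core`) plus a hybrid over the
`k = O(log n)` bits with guessed prefixes, run as a PPT inverter.

## References

* O. Goldreich, L. A. Levin, *A hard-core predicate for all one-way functions*, STOC 1989, 25–32.
* I. Haitner, D. Harnik, O. Reingold, *On the power of the randomized iterate*, CRYPTO 2006,
  LNCS 4117, 22–40; full version ECCC TR05-135, Thm 2.7 (GL for hiding functions, one bit). The
  `O(log n)`-bit form for hiding functions is printed in Liu–Pass's appendix ("[GL89], also see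
  Theorem 2.12 in [HHR06]"), which is the statement vendored here.
* Y. Liu, R. Pass, *On one-way functions and Kolmogorov complexity*, FOCS 2020; arXiv:2009.11514,
  Appendix ("Hardcore functions and the Goldreich–Levin Theorem": Def. of `𝒮`-hiding, Thm [GL89]).
* O. Goldreich, *Foundations of Cryptography I*, CUP 2001, §2.5.2–2.5.3, Thm 2.5.6 (hard-core
  functions with logarithmically many bits).
-/

namespace Literature.Computability.Cryptography

open Finset Filter Asymptotics _root_.Computability Complexity

/-! ### Inner products and the Goldreich–Levin bits -/

/-- The inner product `⟨x, σ⟩ = Σᵢ xᵢσᵢ mod 2` of two bit strings (zipped; surplus bits of the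
longer string are ignored) — the two-argument form of the tree's Goldreich–Levin predicate `glPred`
(which reads `x ‖ r` split in the middle; `glPred_append_eq_ipBit`). [Goldreich–Levin 1989;
Goldreich 2001, Thm 2.5.2 (`b(x,r) = Σ xᵢrᵢ mod 2`)] [cite: GoldreichLevin1989, §1] -/
def ipBit (x σ : List Bool) : Bool :=
  (List.zipWith (· && ·) x σ).foldr Bool.xor false

/-- `glPred (x ‖ r) = ⟨x, r⟩` for `|x| = |r|`: `ipBit` is the predicate of the S24 fact
`goldreich_levin` on separated arguments. [Goldreich 2001, Thm 2.5.2] [folklore] -/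
theorem glPred_append_eq_ipBit {x r : List Bool} (h : x.length = r.length) : glPred (x ++ r) = ipBit x r := by
  have hn : (x ++ r).length / 2 = x.length := by rw [List.length_append, h]; omega
  simp only [glPred, ipBit, hn, List.take_left', List.drop_left']

/-- **The Goldreich–Levin bits** `GL_k(x, σ) = ⟨x, σ₀⟩ ‖ … ‖ ⟨x, σ_{k-1}⟩`, where `σ_j` is the
`j`-th block of `n` bits of `σ`. [Goldreich 2001, Thm 2.5.6 (`g(x, (r¹…r^l)) = b(x,r¹)…b(x,r^l)`);
Liu–Pass 2020, Appendix ("`γ' log n` inner products between `x` and vectors in `σ_GL`")]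
[cite: LiuPassFOCS2020, Lemma 5.3 (proof, Appendix)] -/
def glBits (k n : ℕ) (x σ : List Bool) : List Bool :=
  (List.range k).map fun j => ipBit x ((σ.drop (j * n)).take n)

/-- `GL_k` outputs exactly `k` bits. [folklore] -/
@[simp] theorem length_glBits (k n : ℕ) (x σ : List Bool) : (glBits k n x σ).length = k := by
  simp [glBits]

/-- `⟨x, ε⟩ = 0`. [folklore] -/
@[simp] theorem ipBit_nil_right (x : List Bool) : ipBit x [] = false := by
  cases x <;> simp [ipBit]

/-- `⟨ε, σ⟩ = 0`. [folklore] -/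
@[simp] theorem ipBit_nil_left (σ : List Bool) : ipBit [] σ = false := by
  simp [ipBit]

/-- The recursion `⟨b :: x, c :: σ⟩ = (b ∧ c) ⊕ ⟨x, σ⟩`. [folklore] -/
@[simp] theorem ipBit_cons_cons (b c : Bool) (x σ : List Bool) :
    ipBit (b :: x) (c :: σ) = Bool.xor (b && c) (ipBit x σ) := by
  simp [ipBit]

/-! ### Block seeds -/

/-- **Block seeds** at security parameter `n`: the strings `x ‖ τ` with `x ∈ S_n` and
`τ ∈ {0,1}^b` — the shape of `lpSeeds` of `LiuPassCondFromRegular.lean`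
(`lpSeeds S c n = blockSeeds S (3 * n ^ c) n` holds by `rfl`). [Y. Liu, R. Pass, FOCS 2020, Lemma 5.3
(`x ← S_n, σ₁, σ₂, σ_GL ← {0,1}^{n^c}`)] [folklore] -/
def blockSeeds (S : ∀ n : ℕ, Finset (List.Vector Bool n)) (b n : ℕ) : Finset (List Bool) :=
  (S n ×ˢ (Finset.univ : Finset (List.Vector Bool b))).image fun q => q.1.toList ++ q.2.toList

/-- Members of `blockSeeds S b n` have length `n + b`. [folklore] -/
theorem length_of_mem_blockSeeds {S : ∀ n : ℕ, Finset (List.Vector Bool n)} {b n : ℕ} {w : List Bool}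
    (hw : w ∈ blockSeeds S b n) : w.length = n + b := by
  obtain ⟨q, _, rfl⟩ := Finset.mem_image.1 hw
  simp

/-- Members of `blockSeeds S b n` are exactly the `x ‖ τ`. [folklore] -/
theorem mem_blockSeeds_iff {S : ∀ n : ℕ, Finset (List.Vector Bool n)} {b n : ℕ} {w : List Bool} :
    w ∈ blockSeeds S b n ↔ ∃ x ∈ S n, ∃ τ : List.Vector Bool b, w = x.toList ++ τ.toList := by
  simp only [blockSeeds, Finset.mem_image, Finset.mem_product, Finset.mem_univ, and_true, Prod.exists]
  constructor
  · rintro ⟨x, τ, hx, rfl⟩; exact ⟨x, hx, τ, rfl⟩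
  · rintro ⟨x, hx, τ, rfl⟩; exact ⟨x, τ, hx, rfl⟩

/-- `blockSeeds S b n` is nonempty iff `S_n` is. [folklore] -/
theorem blockSeeds_nonempty_iff {S : ∀ n : ℕ, Finset (List.Vector Bool n)} {b n : ℕ} :
    (blockSeeds S b n).Nonempty ↔ (S n).Nonempty := by
  unfold blockSeeds
  rw [Finset.image_nonempty, Finset.nonempty_product]
  simp

/-- The concatenation map on `S_n × {0,1}^b` is injective (fixed block lengths). [folklore] -/
theorem blockSeeds_map_injective (S : ∀ n : ℕ, Finset (List.Vector Bool n)) (b n : ℕ) :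
    Set.InjOn (fun q : List.Vector Bool n × List.Vector Bool b => q.1.toList ++ q.2.toList)
      (S n ×ˢ (Finset.univ : Finset (List.Vector Bool b)) : Set (List.Vector Bool n × List.Vector Bool b)) := by
  rintro ⟨x, τ⟩ _ ⟨x', τ'⟩ _ h
  have hx : x.toList = x'.toList := by
    have := congrArg (List.take n) h
    simpa [List.take_append_of_le_length] using this
  have hτ : τ.toList = τ'.toList := by
    have := congrArg (List.drop n) h
    simpa [List.drop_append_of_le_length] using this
  simp only [Prod.mk.injEq]
  exact ⟨List.Vector.toList_injective hx, List.Vector.toList_injective hτ⟩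

/-- `|blockSeeds S b n| = |S_n| · 2^b`. [folklore] -/
theorem card_blockSeeds (S : ∀ n : ℕ, Finset (List.Vector Bool n)) (b n : ℕ) :
    (blockSeeds S b n).card = (S n).card * 2 ^ b := by
  unfold blockSeeds
  rw [Finset.card_image_of_injOn (by simpa [Finset.coe_product] using blockSeeds_map_injective S b n),
    Finset.card_product, Finset.card_univ, card_vector, Fintype.card_bool]

/-! ### Hiding -/

/-- `hidingProb g 𝒜 S m n = Pr_{x ← S_n, ρ ← U_{m n}, coins}[𝒜(1ⁿ, g(x ‖ ρ)) = x]`: the probability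
that `𝒜` recovers **the sampled `x` itself** (not just some preimage) from `g(x ‖ ρ)`; `0` when
`S_n = ∅`. [Y. Liu, R. Pass, FOCS 2020, Appendix (Def. "entropically-hiding over `𝒮`"); Haitner–
Harnik–Reingold 2006, §2] [cite: LiuPassFOCS2020, Lemma 5.3 (proof, Appendix: Def. S-hiding)] -/
noncomputable def hidingProb (g : List Bool → List Bool) (A : RandAlg (List Bool) (List Bool))
    (S : ∀ n : ℕ, Finset (List.Vector Bool n)) (m : ℕ → ℕ) (n : ℕ) : ℝ :=
  (∑ x ∈ S n, ∑ ρ : List.Vector Bool (m n),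
      A.pr id (boolPair (unaryEncodeNat n) (g (x.toList ++ ρ.toList))) {z | z = x.toList}) /
    ((S n).card * 2 ^ (m n))

/-- **`𝒮`-hiding randomized function** (print: "entropically-hiding over `𝒮`"): `g`, read as the
randomized function `(x, ρ) ↦ g(x ‖ ρ)` with `|ρ| = m(|x|)`, is `𝒮`-hiding when every PPT
algorithm recovers `x ← S_n` from `(1ⁿ, g(x ‖ ρ))` only with negligible probability. (Weaker than
one-wayness: the attacker must find the very `x` that was used.) [Y. Liu, R. Pass, FOCS 2020,
Appendix, Def. (`𝒮`-hiding); Haitner–Harnik–Reingold 2006 (full version), §2] [cite: LiuPassFOCS2020, Lemma 5.3 (proof, Appendix: Def. S-hiding)] -/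
def IsHidingOver (g : List Bool → List Bool) (S : ∀ n : ℕ, Finset (List.Vector Bool n)) (m : ℕ → ℕ) : Prop :=
  ∀ A : RandAlg (List Bool) (List Bool), IsPPT A id →
    SuperpolynomialDecay atTop (fun n : ℕ => (n : ℝ)) (hidingProb g A S m)

/-- `hidingProb ≥ 0`. [folklore] -/
theorem hidingProb_nonneg (g : List Bool → List Bool) (A : RandAlg (List Bool) (List Bool))
    (S : ∀ n : ℕ, Finset (List.Vector Bool n)) (m : ℕ → ℕ) (n : ℕ) : 0 ≤ hidingProb g A S m n :=
  div_nonneg (sum_nonneg fun _ _ => sum_nonneg fun _ _ => A.pr_nonneg _ _ _) (by positivity)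

/-! ### The two ensembles of the Goldreich–Levin theorem -/

/-- The **real** sample on a block seed `w = x ‖ ρ ‖ σ` (`|x| = n`, `|ρ| = m`, `|σ| = k·n`):
`g(x ‖ ρ) ‖ σ ‖ GL_k(x, σ)`. [Y. Liu, R. Pass, FOCS 2020, Appendix (Thm [GL89]: `f'(x,r,σ) = σ ‖ f(x,r)`
with the hard-core bits `GL`)] [folklore] -/
def glReal (g : List Bool → List Bool) (m k n : ℕ) (w : List Bool) : List Bool :=
  g (w.take (n + m)) ++ (w.drop (n + m)).take (k * n) ++ glBits k n (w.take n) ((w.drop (n + m)).take (k * n))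

/-- The **ideal** sample on a block seed `w = x ‖ ρ ‖ σ ‖ u` (`|u| = k`): `g(x ‖ ρ) ‖ σ ‖ u`, the
hard-core bits replaced by the fresh seed block `u`. [Y. Liu, R. Pass, FOCS 2020, Appendix
(Def. hardcore function: `f(x) ‖ U_{v(n)}`)] [folklore] -/
def glIdeal (g : List Bool → List Bool) (m n : ℕ) (w : List Bool) : List Bool :=
  g (w.take (n + m)) ++ w.drop (n + m)

/-- The real ensemble `{x ← S_n, ρ, σ : g(x‖ρ) ‖ σ ‖ GL_{k(n)}(x, σ)}`, `k(n) = d⌊log₂ n⌋`.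
[cite: LiuPassFOCS2020, Lemma 5.3 (proof, Appendix: Thm GL89)] -/
noncomputable def glRealEns (g : List Bool → List Bool) (S : ∀ n : ℕ, Finset (List.Vector Bool n))
    (m : ℕ → ℕ) (d : ℕ) : Ensemble (List Bool) := fun n =>
  (condUniform (blockSeeds S (m n + d * Nat.log 2 n * n) n)).map (glReal g (m n) (d * Nat.log 2 n) n)

/-- The ideal ensemble `{x ← S_n, ρ, σ, u : g(x‖ρ) ‖ σ ‖ u}`, `|u| = d⌊log₂ n⌋`.
[cite: LiuPassFOCS2020, Lemma 5.3 (proof, Appendix: Thm GL89)] -/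
noncomputable def glIdealEns (g : List Bool → List Bool) (S : ∀ n : ℕ, Finset (List.Vector Bool n))
    (m : ℕ → ℕ) (d : ℕ) : Ensemble (List Bool) := fun n =>
  (condUniform (blockSeeds S (m n + d * Nat.log 2 n * n + d * Nat.log 2 n) n)).map (glIdeal g (m n) n)

/-- **The Goldreich–Levin theorem for hiding functions, `O(log n)` bits** (named fact, D-0014).
For every family `𝒮 = {S_n ⊆ {0,1}ⁿ}` of eventually nonempty sets, every randomized function
`g(x ‖ ρ)` with randomness length `m(·)` (any function), and every `d`: if `g` is `𝒮`-hiding (`IsHidingOver`) then the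
ensembles `{g(x‖ρ) ‖ σ ‖ GL_{d⌊log₂ n⌋}(x, σ)}` and `{g(x‖ρ) ‖ σ ‖ U_{d⌊log₂ n⌋}}`
(`x ← S_n`, `ρ ← U_{m(n)}`, `σ ← U_{d⌊log₂ n⌋·n}`) are computationally indistinguishable — i.e.
`GL` is a hard-core function for `(x, ρ, σ) ↦ σ ‖ g(x ‖ ρ)` over `𝒮`. This `O(log n)`-bit form for
hiding functions is the theorem printed in Liu–Pass 2020, Appendix ("[GL89], also see Theorem 2.12
in [HHR06]"; for one-way `f` it is [GL89] / Goldreich 2001 Thm 2.5.6, and the one-bit form for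
hiding functions is Thm 2.7 of the full version of Haitner–Harnik–Reingold); the printed proof
(Rackoff's pairwise independent list decoding, cf. `goldreich_levin_core` in `GoldreichLevin.lean`,
a hybrid over the `O(log n)` output bits with guessed prefixes, and Markov averaging over `(x, ρ)`)
is not carried out here. [O. Goldreich, L. Levin, STOC 1989; Y. Liu, R. Pass, FOCS 2020
(arXiv:2009.11514), Appendix, Thm [GL89]] [cite: LiuPassFOCS2020, Appendix (Thm [GL89], hardcore functions for S-hiding f)] -/
def goldreichLevin_hiding : Prop :=
  ∀ (S : ∀ n : ℕ, Finset (List.Vector Bool n)) (g : List Bool → List Bool) (m : ℕ → ℕ) (d : ℕ),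
    (∀ᶠ n in atTop, (S n).Nonempty) → IsHidingOver g S m →
      IsCompIndistinguishable (glRealEns g S m d) (glIdealEns g S m d)

/-! ### Unfolding lemmas -/

/-- The real sample on a well-formed seed. [folklore] -/
theorem glReal_seed (g : List Bool → List Bool) {m k n : ℕ} (x : List.Vector Bool n) (ρ : List.Vector Bool m)
    (σ : List.Vector Bool (k * n)) :
    glReal g m k n (x.toList ++ ρ.toList ++ σ.toList) =
      g (x.toList ++ ρ.toList) ++ σ.toList ++ glBits k n x.toList σ.toList := by
  have h1 : (x.toList ++ ρ.toList ++ σ.toList).take (n + m) = x.toList ++ ρ.toList := by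
    rw [List.take_append_of_le_length (by simp)]
    simp [List.take_of_length_le]
  have h2 : (x.toList ++ ρ.toList ++ σ.toList).drop (n + m) = σ.toList := by
    rw [List.drop_append_of_le_length (by simp)]
    simp [List.drop_of_length_le]
  have h3 : (x.toList ++ ρ.toList ++ σ.toList).take n = x.toList := by
    rw [List.append_assoc, List.take_append_of_le_length (by simp)]
    simp [List.take_of_length_le]
  simp only [glReal, h1, h2, h3, List.take_of_length_le (le_of_eq (List.Vector.toList_length σ))]

/-- The ideal sample on a well-formed seed. [folklore] -/
theorem glIdeal_seed (g : List Bool → List Bool) {m n : ℕ} (x : List.Vector Bool n) (ρ : List.Vector Bool m)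
    (τ : List Bool) :
    glIdeal g m n (x.toList ++ ρ.toList ++ τ) = g (x.toList ++ ρ.toList) ++ τ := by
  have h1 : (x.toList ++ ρ.toList ++ τ).take (n + m) = x.toList ++ ρ.toList := by
    rw [List.take_append_of_le_length (by simp)]
    simp [List.take_of_length_le]
  have h2 : (x.toList ++ ρ.toList ++ τ).drop (n + m) = τ := by
    rw [List.drop_append_of_le_length (by simp)]
    simp [List.drop_of_length_le]
  simp only [glIdeal, h1, h2]

/-- Length of the real sample when `g` has output length `L` on `x ‖ ρ`. [folklore] -/
theorem length_glReal (g : List Bool → List Bool) {m k n L : ℕ} (x : List.Vector Bool n) (ρ : List.Vector Bool m)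
    (σ : List.Vector Bool (k * n)) (hg : (g (x.toList ++ ρ.toList)).length = L) :
    (glReal g m k n (x.toList ++ ρ.toList ++ σ.toList)).length = L + k * n + k := by
  rw [glReal_seed, List.length_append, List.length_append, hg, length_glBits, List.Vector.toList_length]

end Literature.Computability.Cryptography
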